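import Summits.Ventures.HodgeRepro.CMRank
import Summits.Ventures.HodgeRepro.SingleClass
import Summits.Ventures.HodgeRepro.FaceReduce

/-!
# Every finite Galois CM type: a single-class `SumTwo` quadruple without a conjugate pair needs a
DEGENERATE type (character-free proof)

Blind re-derivation cell `pub-hodge-repro`, seat `p1` (gen 7).  Removes the ABELIAN hypothesis of
`NondegenerateNoSingleClass.lean` (p1 g6): the same statement for EVERY finite group `G` with a complex
conjugation `c`, by linear algebra on typer's `cmRank` (`CMRank.lean`) alone — no characters, no Kubota
formula, no Fourier inversion, and no dependency on `KubotaLit2` / `LitRankChar`.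

**Theorem** (`exists_conj_of_sumTwo_of_isNondegenerate`): `G` finite, `c` a complex conjugation, `Φ` a
NON-DEGENERATE CM type (`cmRank Φ = |Φ| + 1`), `T = (Φ g₀, Φ g₁, Φ g₂, Φ g₃)` a `SumTwo` quadruple of
right twists of `Φ`.  Then two corners are complex conjugate: `T j = c • T i`.  Equivalently
(`not_isSingleClass_of_isNondegenerate`, the shape of typer's `QuadFinset12.lean` rows): a single-class
`SumTwo` quadruple without a conjugate pair forces a DEGENERATE type — the combinatorial shadow of
Hazama's theorem ([Gordon] Thm 6.4 / §9.3, `route/SOURCES.md`) in the cell's vocabulary, now for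
non-abelian Galois groups too (control: all 1792 single-class instances of order 16, the 384 + 192
non-coset instances of `SD₁₆` / `M₁₆` included, have base types of rank 7 resp. 5 < 9,
`proofs/p1-g7/rank16.out`).

Proof.  Let `W = span {ind (aΦ) : a ∈ G}` be the row space of `typeMatrix Φ` (`finrank W = cmRank Φ`) and
`U = {f : G → ℚ | f x + f (c x)` independent of `x}`.
(A) `W ≤ U` (`ind (aΦ) + ind (c a Φ) = 1`), and `U` is spanned by the `|Φ| + 1` vectors `1` and
`δ_y − δ_{c y}` (`y ∈ Φ`) — the family `oddGen` (`mem_span_oddGen`).  Non-degeneracy gives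
`finrank W = |Φ| + 1 ≥ finrank (span oddGen)`, hence `W = span oddGen` (`span_ind_smul_eq_span_oddGen`).
(B) The twist operator `Σ_g f := (x ↦ ∑ᵢ f (x gᵢ⁻¹))` is linear and commutes with left translation;
`SumTwo` says `Σ_g (ind (aΦ)) = 2` for every `a` (`twistSum_ind_smul`), so `Σ_g f` is CONSTANT for every
`f ∈ W` (`twistSum_const_of_mem_span`).
(C) Apply (B) to `f₀ = δ_1 − δ_c ∈ U = W`: `Σ_g f₀ (x) = #{i : gᵢ = x} − #{i : gᵢ = c x}` is constant in
`x`; comparing `x = g₀` with `x = c g₀` the constant is its own negative, so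
`#{i : gᵢ = c g₀} = #{i : gᵢ = g₀} ≥ 1`: some `gⱼ = c g₀`, i.e. `T j = c • T 0`.
-/

set_option autoImplicit false

open Finset Module
open scoped Pointwise

namespace HodgeRepro.HazamaShadow

variable {G : Type*} [Group G]

/-! ### The twist operator and three identities for an involution -/

/-- The twist operator of a quadruple `g : Fin 4 → G`: `f ↦ (x ↦ ∑ᵢ f (x · gᵢ⁻¹))`, the sum of the right
translates of `f` by the `gᵢ`; a linear endomorphism of `G → ℚ`. -/
def twistSum (g : Fin 4 → G) : (G → ℚ) →ₗ[ℚ] (G → ℚ) where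
  toFun f := fun x => ∑ i, f (x * (g i)⁻¹)
  map_add' f₁ f₂ := by
    funext x
    simp only [Pi.add_apply, Finset.sum_add_distrib]
  map_smul' r f := by
    funext x
    simp only [Pi.smul_apply, smul_eq_mul, RingHom.id_apply, Finset.mul_sum]

/-- The twist operator, pointwise. -/
theorem twistSum_apply (g : Fin 4 → G) (f : G → ℚ) (x : G) :
    twistSum g f x = ∑ i, f (x * (g i)⁻¹) := rfl

/-- `x = c y ↔ c x = y` for an involution `c`. -/
theorem eq_conj_mul_iff {c : G} (hc : IsComplexConj c) (x y : G) : x = c * y ↔ c * x = y := by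
  constructor
  · rintro rfl
    exact hc.mul_mul_cancel y
  · rintro rfl
    exact (hc.mul_mul_cancel x).symm

/-- `c x = 1 ↔ x = c`. -/
theorem conj_mul_eq_one_iff {c : G} (hc : IsComplexConj c) (x : G) : c * x = 1 ↔ x = c := by
  constructor
  · intro h
    calc x = c * (c * x) := (hc.mul_mul_cancel x).symm
      _ = c := by rw [h, mul_one]
  · rintro rfl
    exact hc.mul_self

/-- `c x = c ↔ x = 1`. -/
theorem conj_mul_eq_conj_iff {c : G} (hc : IsComplexConj c) (x : G) : c * x = c ↔ x = 1 := by
  constructor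
  · intro h
    calc x = c * (c * x) := (hc.mul_mul_cancel x).symm
      _ = 1 := by rw [h, hc.mul_self]
  · rintro rfl
    exact mul_one c

section Decidable

variable [DecidableEq G]

/-! ### `SumTwo` makes the twist operator constant on the row space -/

/-- `SumTwo` for the twists `Φ gᵢ` makes the twist operator send EVERY row `ind (aΦ)` of the type matrix
to the constant `2` (left translation commutes with the right twists). -/
theorem twistSum_ind_smul {Φ : Finset G} {g : Fin 4 → G} (hs : SumTwo fun i => rmul Φ (g i)) (a : G) :
    twistSum g (ind (a • Φ)) = fun _ => 2 := by
  funext x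
  have h2 : (univ.filter fun i => a⁻¹ * x ∈ rmul Φ (g i)).card = 2 := hs (a⁻¹ * x)
  rw [twistSum_apply]
  have key : ∀ i, ind (a • Φ) (x * (g i)⁻¹) = if a⁻¹ * x ∈ rmul Φ (g i) then 1 else 0 := by
    intro i
    rw [ind_smul, ind_apply, ← mul_assoc]
    exact if_congr mem_rmul.symm rfl rfl
  simp only [key]
  rw [Finset.sum_boole]
  exact_mod_cast h2

/-- On the row space `W` of the type matrix the twist operator takes CONSTANT values. -/
theorem twistSum_const_of_mem_span {Φ : Finset G} {g : Fin 4 → G} (hs : SumTwo fun i => rmul Φ (g i))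
    {f : G → ℚ} (hf : f ∈ Submodule.span ℚ (Set.range fun a : G => ind (a • Φ))) :
    ∃ k : ℚ, twistSum g f = fun _ => k := by
  induction hf using Submodule.span_induction with
  | mem v hv =>
    obtain ⟨a, rfl⟩ := hv
    exact ⟨2, twistSum_ind_smul hs a⟩
  | zero =>
    refine ⟨0, funext fun x => ?_⟩
    simp only [map_zero, Pi.zero_apply]
  | add v w _ _ hv hw =>
    obtain ⟨k, hk⟩ := hv
    obtain ⟨l, hl⟩ := hw
    refine ⟨k + l, funext fun x => ?_⟩
    simp only [map_add, Pi.add_apply, hk, hl]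
  | smul r v _ hv =>
    obtain ⟨k, hk⟩ := hv
    refine ⟨r * k, funext fun x => ?_⟩
    simp only [map_smul, Pi.smul_apply, hk, smul_eq_mul]

/-! ### The space `U` of functions with `f x + f (c x)` constant -/

/-- The spanning family of `U`: `none ↦ 1`, `some y ↦ δ_y − δ_{c y}` for `y ∈ Φ` (`|Φ| + 1` vectors). -/
def oddGen (c : G) (Φ : Finset G) : Option Φ → G → ℚ
  | none => fun _ => 1
  | some y => fun x => (if x = (y : G) then 1 else 0) - (if x = c * y then 1 else 0)

/-- Evaluating `∑_{y ∈ Φ} a y • (δ_y − δ_{c y})` at a point `x`: the coefficient of `x` if `x ∈ Φ`, minus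
the coefficient of `c x` if `c x ∈ Φ`. -/
theorem sum_oddGen_some_apply {c : G} (hc : IsComplexConj c) (Φ : Finset G) (a : G → ℚ) (x : G) :
    (∑ y : Φ, a y • oddGen c Φ (some y)) x =
      (if x ∈ Φ then a x else 0) - (if c * x ∈ Φ then a (c * x) else 0) := by
  rw [Finset.sum_apply]
  have h1 : ∀ y : Φ, (a y • oddGen c Φ (some y)) x =
      (if x = (y : G) then a y else 0) - (if c * x = (y : G) then a y else 0) := by
    intro y
    simp only [Pi.smul_apply, oddGen, smul_eq_mul, mul_sub, mul_ite, mul_one, mul_zero,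
      eq_conj_mul_iff hc]
  simp only [h1]
  rw [Finset.sum_sub_distrib, Finset.sum_coe_sort Φ (fun y => if x = y then a y else 0),
    Finset.sum_coe_sort Φ (fun y => if c * x = y then a y else 0), Finset.sum_ite_eq,
    Finset.sum_ite_eq]

/-- Every `f` with `f x + f (c x)` independent of `x` lies in the span of `oddGen c Φ`: with
`k = f 1 + f c`, `f = (k/2) · 1 + ∑_{y ∈ Φ} (f y − k/2) (δ_y − δ_{c y})`. -/
theorem mem_span_oddGen {c : G} (hc : IsComplexConj c) {Φ : Finset G} (hΦ : IsCMType c Φ)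
    (f : G → ℚ) (hf : ∀ x, f x + f (c * x) = f 1 + f c) :
    f ∈ Submodule.span ℚ (Set.range (oddGen c Φ)) := by
  rw [Submodule.mem_span_range_iff_exists_fun]
  refine ⟨fun o => o.elim ((f 1 + f c) / 2) (fun y => f y - (f 1 + f c) / 2), ?_⟩
  rw [Fintype.sum_option]
  funext x
  simp only [Option.elim_none, Option.elim_some]
  rw [Pi.add_apply, sum_oddGen_some_apply hc Φ (fun y => f y - (f 1 + f c) / 2) x]
  simp only [oddGen, Pi.smul_apply, smul_eq_mul, mul_one]
  have hx := hf x
  rcases hΦ.mem_or_conj_mem x with h | h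
  · have h' : c * x ∉ Φ := (hΦ x).1 h
    rw [if_pos h, if_neg h']
    ring
  · have h' : x ∉ Φ := (hΦ.conj_mem_iff x).1 h
    rw [if_neg h', if_pos h]
    linarith

/-! ### The test vector `δ_1 − δ_c` and the multiplicity count -/

/-- The test vector `f₀ = δ_1 − δ_c`. -/
def testVec (c : G) : G → ℚ := fun x => (if x = 1 then 1 else 0) - (if x = c then 1 else 0)

/-- The multiplicity of `x` among the twists: `#{i : gᵢ = x}` (as a rational number). -/
def mult (g : Fin 4 → G) (x : G) : ℚ := ∑ i, if g i = x then 1 else 0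

/-- The twist operator on the test vector counts twists: `Σ_g f₀ (x) = #{i : gᵢ = x} − #{i : gᵢ = c x}`. -/
theorem twistSum_testVec {c : G} (hc : IsComplexConj c) (g : Fin 4 → G) (x : G) :
    twistSum g (testVec c) x = mult g x - mult g (c * x) := by
  simp only [twistSum_apply, mult]
  rw [← Finset.sum_sub_distrib]
  refine Finset.sum_congr rfl fun i _ => ?_
  have e1 : x * (g i)⁻¹ = 1 ↔ g i = x := by
    rw [mul_inv_eq_one]
    exact eq_comm
  have e2 : x * (g i)⁻¹ = c ↔ g i = c * x := by
    rw [mul_inv_eq_iff_eq_mul, eq_conj_mul_iff hc x (g i)]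
    exact eq_comm
  simp only [testVec, e1, e2]

omit [Group G] in
/-- `#{i : gᵢ = g 0} ≥ 1`. -/
theorem one_le_mult_self (g : Fin 4 → G) : 1 ≤ mult g (g 0) := by
  unfold mult
  calc (1 : ℚ) = if g 0 = g 0 then 1 else 0 := by rw [if_pos rfl]
    _ ≤ ∑ i, if g i = g 0 then (1 : ℚ) else 0 :=
        Finset.single_le_sum (f := fun i => if g i = g 0 then (1 : ℚ) else 0)
          (fun i _ => by split_ifs <;> norm_num) (Finset.mem_univ (0 : Fin 4))

omit [Group G] in
/-- A positive multiplicity is witnessed by a twist. -/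
theorem exists_eq_of_mult_ne_zero (g : Fin 4 → G) (x : G) (h : mult g x ≠ 0) : ∃ j, g j = x := by
  unfold mult at h
  obtain ⟨j, _, hj⟩ := Finset.exists_ne_zero_of_sum_ne_zero h
  refine ⟨j, ?_⟩
  by_contra hne
  exact hj (if_neg hne)

end Decidable

section Finite

variable [Fintype G] [DecidableEq G]

/-! ### Non-degeneracy: the row space is all of `U` -/

/-- Every row `ind (aΦ)` of the type matrix lies in the span of `oddGen c Φ`
(`ind (aΦ) x + ind (aΦ) (c x) = 1`). -/
theorem ind_smul_mem_span_oddGen {c : G} (hc : IsComplexConj c) {Φ : Finset G} (hΦ : IsCMType c Φ)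
    (a : G) : ind (a • Φ) ∈ Submodule.span ℚ (Set.range (oddGen c Φ)) := by
  apply mem_span_oddGen hc hΦ
  have h : ∀ x, ind (a • Φ) x + ind (a • Φ) (c * x) = 1 := by
    intro x
    have := ind_smul_add_ind_conj_smul hc hΦ a x
    rwa [ind_smul c (a • Φ) x, hc.inv_eq] at this
  have h1 := h 1
  rw [mul_one] at h1
  intro x
  rw [h x, h1]

/-- **Non-degeneracy ⇒ the row space of the type matrix is all of `U`**:
`span {ind (aΦ)} = span (oddGen c Φ)`. -/
theorem span_ind_smul_eq_span_oddGen {c : G} (hc : IsComplexConj c) {Φ : Finset G}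
    (hΦ : IsCMType c Φ) (hnd : IsNondegenerate Φ) :
    Submodule.span ℚ (Set.range fun a : G => ind (a • Φ)) =
      Submodule.span ℚ (Set.range (oddGen c Φ)) := by
  apply Submodule.eq_of_le_of_finrank_le
  · exact Submodule.span_le.2 (Set.range_subset_iff.2 fun a => ind_smul_mem_span_oddGen hc hΦ a)
  · have hW : finrank ℚ (Submodule.span ℚ (Set.range fun a : G => ind (a • Φ))) = Φ.card + 1 := by
      rw [← cmRank_eq_finrank_span]
      exact hnd
    rw [hW]
    calc finrank ℚ (Submodule.span ℚ (Set.range (oddGen c Φ))) ≤ Fintype.card (Option Φ) :=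
          finrank_range_le_card (oddGen c Φ)
      _ = Φ.card + 1 := by rw [Fintype.card_option, Fintype.card_coe]

/-- The test vector lies in `U`, hence (non-degenerate `Φ`) in the row space of the type matrix. -/
theorem testVec_mem_span {c : G} (hc : IsComplexConj c) {Φ : Finset G} (hΦ : IsCMType c Φ)
    (hnd : IsNondegenerate Φ) :
    testVec c ∈ Submodule.span ℚ (Set.range fun a : G => ind (a • Φ)) := by
  rw [span_ind_smul_eq_span_oddGen hc hΦ hnd]
  apply mem_span_oddGen hc hΦ
  intro x
  simp only [testVec, conj_mul_eq_one_iff hc, conj_mul_eq_conj_iff hc, hc.ne_one, hc.ne_one.symm,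
    if_true, if_false]
  ring

/-! ### The theorem -/

/-- **Non-degenerate `Φ`, any finite `G`: every `SumTwo` quadruple of twists of `Φ` contains the conjugate
twist of its first corner**: some `gⱼ = c g₀`. -/
theorem exists_eq_conj_mul_of_sumTwo {c : G} (hc : IsComplexConj c) {Φ : Finset G}
    (hΦ : IsCMType c Φ) (hnd : IsNondegenerate Φ) {g : Fin 4 → G}
    (hs : SumTwo fun i => rmul Φ (g i)) : ∃ j : Fin 4, g j = c * g 0 := by
  obtain ⟨k, hk⟩ := twistSum_const_of_mem_span hs (testVec_mem_span hc hΦ hnd)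
  have h1 : mult g (g 0) - mult g (c * g 0) = k := by
    rw [← twistSum_testVec hc, hk]
  have h2 : mult g (c * g 0) - mult g (g 0) = k := by
    have := twistSum_testVec hc g (c * g 0)
    rw [hk, hc.mul_mul_cancel] at this
    exact this.symm
  have h3 := one_le_mult_self g
  apply exists_eq_of_mult_ne_zero
  intro h0
  linarith

/-- **Every finite `G`, non-degenerate `Φ`: a `SumTwo` quadruple of twists of `Φ` has a conjugate pair**
(`T j = c • T 0`). -/
theorem exists_conj_of_sumTwo_of_isNondegenerate {c : G} (hc : IsComplexConj c) {Φ : Finset G}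
    (hΦ : IsCMType c Φ) (hnd : IsNondegenerate Φ) {g : Fin 4 → G}
    (hs : SumTwo fun i => rmul Φ (g i)) :
    ∃ i j : Fin 4, rmul Φ (g j) = c • rmul Φ (g i) := by
  obtain ⟨j, hj⟩ := exists_eq_conj_mul_of_sumTwo hc hΦ hnd hs
  have hsr : ∀ S : Finset G, c • S = rmul S c := by
    intro S
    ext x
    rw [hc.mem_smul_iff, mem_rmul, hc.inv_eq, hc.comm]
  refine ⟨0, j, ?_⟩
  rw [hj, hsr, rmul_rmul, hc.comm]

/-- **Single-class, `SumTwo`, no conjugate pair ⇒ degenerate, for EVERY finite `(G, c)`**: the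
character-free, non-abelian form of p1 g6's `HodgeRepro.not_isSingleClass_of_isNondegenerate`
(the hypothesis typer's `not_isSingleClass_<G>` rows and the degree-16 witnesses are about). -/
theorem not_isSingleClass_of_isNondegenerate {c : G} (hc : IsComplexConj c)
    (T : Fin 4 → Finset G) (hT : IsCMType c (T 0)) (hnd : IsNondegenerate (T 0)) (hs : SumTwo T)
    (hnc : ∀ i j : Fin 4, T j ≠ c • T i) : ¬ IsSingleClass T := by
  intro hsc
  choose g hg using hsc
  have hs' : SumTwo fun i => rmul (T 0) (g i) := by
    have : (fun i => rmul (T 0) (g i)) = T := by funext i; exact (hg i).symm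
    rw [this]; exact hs
  obtain ⟨i, j, hij⟩ := exists_conj_of_sumTwo_of_isNondegenerate hc hT hnd hs'
  exact hnc i j (by rw [hg j, hg i]; exact hij)

end Finite

end HodgeRepro.HazamaShadow
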